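import Summits.NavierStokesRegularity.NavierStokesRegularity.Theses.HodographBetchov
import Literature.Analysis.FluidPDE.LerayGaugeStrainSpectrum

/-!
# `FastClassSqueeze` (stmt-NavierStokesRegularity-15832) in closed form: the middle principal strain

Route `HodographBetchov`, crux 3.  The crux quantifies over a nonnegative majorant `m` and, at every
fast point, over an orthonormal pair `v, w` ("min–max clause").  By Courant–Fischer for the middle
eigenvalue of three (`Literature.Analysis.FluidPDE.strainEigenvalues_mid_le_iff`, Horn–Johnson
Thm. 4.2.6) the clause says exactly `λ₂(sym ∇u(t,x)) ≤ m(t,x)`, where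
`λ₂ = strainEigenvalues (∇u) _ 1` is the middle principal strain (no new definition is introduced:
the tree's `strainEigenvalues` is used inline); and since `ENNReal.ofReal` clips
negative values, the least admissible integrand is `ofReal λ₂ = ofReal λ₂⁺`.  Hence

`fastClassSqueeze_iff_middleStrain`:
`FastClassSqueeze ↔` along every such solution `∃ l > 0, q > 3/2` with
`∫₀ᵀ (∫_{|u(t)|>l} (λ₂⁺)^q)^{2/(2q−3)} < ∞` — Miller's (2019, Thm. 1.1) hypothesis verbatim on the
fast class, with no auxiliary quantifiers.  Both directions are pointwise monotonicity; the only
measure theory is that the fast class `{|u(t)| > l}` is measurable for `t < T` (continuity of the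
classical slice), used to compare the inner integrals almost everywhere in `t`.
-/

noncomputable section

-- the summit and its single problem share the name `NavierStokesRegularity` (D-0017 nested layout)
set_option linter.dupNamespace false

namespace Summit.NavierStokesRegularity.NavierStokesRegularity.Theorems.FastClassSqueeze

open Set MeasureTheory Filter Topology Literature.Analysis.FluidPDE
open scoped ENNReal NNReal RealInnerProductSpace

/-- The min–max clause of `FastClassSqueeze` at a point is `λ₂(sym A) ≤ a` (Courant–Fischer for the
middle eigenvalue of three, `strainEigenvalues_mid_le_iff`). [cite: HornJohnson2013, Thm 4.2.6] -/
theorem middleStrain_le_iff (A : EuclideanSpace ℝ (Fin 3) →L[ℝ] EuclideanSpace ℝ (Fin 3)) (a : ℝ) :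
    strainEigenvalues (A : EuclideanSpace ℝ (Fin 3) →ₗ[ℝ] EuclideanSpace ℝ (Fin 3))
        finrank_euclideanSpace_fin 1 ≤ a ↔
      ∃ v w : EuclideanSpace ℝ (Fin 3), ‖v‖ = 1 ∧ ‖w‖ = 1 ∧ inner ℝ v w = 0 ∧
        ∀ α β : ℝ, inner ℝ (A (α • v + β • w)) (α • v + β • w) ≤ a * (α ^ 2 + β ^ 2) := by
  rw [strainEigenvalues_mid_le_iff]
  simp only [ContinuousLinearMap.coe_coe]

/-- **`FastClassSqueeze` in closed form.** The crux holds iff along every classical solution of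
unforced Navier–Stokes on `ℝ³ × [0,T)` that is Leray–Hopf from a rapidly decaying datum there are
`l > 0` and `q > 3/2` with `∫₀ᵀ (∫_{|u(t)|>l} (ofReal λ₂(sym ∇u(t,x)))^q dx)^{2/(2q−3)} dt < ∞`
(`ofReal` clips `λ₂` at `0`, so this is Miller's `λ₂⁺` mixed norm on the fast class, `2/p + 3/q = 2`).
`→`: an admissible `m` majorises `λ₂` at fast points (Courant–Fischer), and the integrals are monotone
(a.e. in `t`, the fast class being measurable for `t < T`).  `←`: `m := max λ₂ 0` is admissible.
[cite: Miller2019, Thm 1.1] -/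
theorem fastClassSqueeze_iff_middleStrain :
    Summit.NavierStokesRegularity.NavierStokesRegularity.Theses.HodographBetchov.FastClassSqueeze ↔
    ∀ (ν T : ℝ), 0 < ν → 0 < T →
      ∀ (u : ℝ → EuclideanSpace ℝ (Fin 3) → EuclideanSpace ℝ (Fin 3))
        (p : ℝ → EuclideanSpace ℝ (Fin 3) → ℝ),
        Literature.Analysis.FluidPDE.IsClassicalNSSolutionOn (Set.Ico 0 T) ν 0 u p →
        Literature.Analysis.FluidPDE.IsLerayHopfOn T ν 0 (u 0) u →
        Literature.Analysis.FluidPDE.HasRapidSpatialDecay (u 0) →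
        ∃ l : ℝ, 0 < l ∧ ∃ q : ℝ, 3 / 2 < q ∧
          ∫⁻ t in Set.Ioo 0 T, (∫⁻ x in {x : EuclideanSpace ℝ (Fin 3) | l < ‖u t x‖},
            ENNReal.ofReal (Literature.Analysis.FluidPDE.strainEigenvalues
              ((fderiv ℝ (u t) x : EuclideanSpace ℝ (Fin 3) →L[ℝ] EuclideanSpace ℝ (Fin 3)) :
                EuclideanSpace ℝ (Fin 3) →ₗ[ℝ] EuclideanSpace ℝ (Fin 3))
              finrank_euclideanSpace_fin 1) ^ q) ^ (2 / (2 * q - 3)) < ⊤ := by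
  constructor
  · intro h ν T hν hT u p hcl hLH hdec
    obtain ⟨l, hl, q, hq, m, -, hclause, hint⟩ := h ν T hν hT u p hcl hLH hdec
    refine ⟨l, hl, q, hq, lt_of_le_of_lt ?_ hint⟩
    have hq0 : 0 ≤ q := by linarith
    have hr0 : 0 ≤ 2 / (2 * q - 3) := div_nonneg zero_le_two (by linarith)
    refine lintegral_mono_ae ?_
    filter_upwards [ae_restrict_mem measurableSet_Ioo] with t ht
    refine ENNReal.rpow_le_rpow ?_ hr0
    have hF : MeasurableSet {x : EuclideanSpace ℝ (Fin 3) | l < ‖u t x‖} :=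
      measurableSet_lt measurable_const
        (hcl.contDiff_velocity (Ioo_subset_Ico_self ht)).continuous.norm.measurable
    refine setLIntegral_mono' hF fun x hx => ?_
    refine ENNReal.rpow_le_rpow (ENNReal.ofReal_le_ofReal ?_) hq0
    exact (middleStrain_le_iff _ _).2 (hclause t (Ioo_subset_Ico_self ht) x hx)
  · intro h ν T hν hT u p hcl hLH hdec
    obtain ⟨l, hl, q, hq, hint⟩ := h ν T hν hT u p hcl hLH hdec
    refine ⟨l, hl, q, hq, fun t x => max (strainEigenvalues
        ((fderiv ℝ (u t) x : EuclideanSpace ℝ (Fin 3) →L[ℝ] EuclideanSpace ℝ (Fin 3)) :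
          EuclideanSpace ℝ (Fin 3) →ₗ[ℝ] EuclideanSpace ℝ (Fin 3)) finrank_euclideanSpace_fin 1) 0,
      fun t x => le_max_right _ _, ?_, ?_⟩
    · intro t _ x _
      exact (middleStrain_le_iff _ _).1 (le_max_left _ _)
    · have heq : ∀ t x, ENNReal.ofReal (max (strainEigenvalues
            ((fderiv ℝ (u t) x : EuclideanSpace ℝ (Fin 3) →L[ℝ] EuclideanSpace ℝ (Fin 3)) :
              EuclideanSpace ℝ (Fin 3) →ₗ[ℝ] EuclideanSpace ℝ (Fin 3)) finrank_euclideanSpace_fin 1) 0) =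
          ENNReal.ofReal (strainEigenvalues
            ((fderiv ℝ (u t) x : EuclideanSpace ℝ (Fin 3) →L[ℝ] EuclideanSpace ℝ (Fin 3)) :
              EuclideanSpace ℝ (Fin 3) →ₗ[ℝ] EuclideanSpace ℝ (Fin 3)) finrank_euclideanSpace_fin 1) := by
        intro t x
        rcases le_or_gt 0 (strainEigenvalues
            ((fderiv ℝ (u t) x : EuclideanSpace ℝ (Fin 3) →L[ℝ] EuclideanSpace ℝ (Fin 3)) :
              EuclideanSpace ℝ (Fin 3) →ₗ[ℝ] EuclideanSpace ℝ (Fin 3)) finrank_euclideanSpace_fin 1)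
          with h0 | h0
        · rw [max_eq_left h0]
        · rw [max_eq_right h0.le, ENNReal.ofReal_zero, ENNReal.ofReal_of_nonpos h0.le]
      simp_rw [heq]
      exact hint

end Summit.NavierStokesRegularity.NavierStokesRegularity.Theorems.FastClassSqueeze

end
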